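import Summits.BirchSwinnertonDyer.BirchSwinnertonDyer.Theorems.PrintCf2RamifiedOffTYZTheoremACMAssembly
import Literature.NumberTheory.QuadraticFields.FourRankOneKernelCriterion
import Literature.NumberTheory.NumberFields.NarrowClassGroupCounting
import HarnessLib

/-!
# Route `PrintCf2`, crux stmt-BirchSwinnertonDyer-20509 `RamifiedOffTYZOfFacts`, THEOREM A's target (T3), GLOBAL HALF — the group theory:
# `g` fixes the genus square root `w` ⟹ `g^m` fixes `s₀`, from «`Gal(R/H)` fixes `a₀ = s₀²`», «`#Cl[2] = 2`», «the ambiguous class has a lift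
# `p` with `p²` fixing `s₀`» and «`#Cl = 2m`, `m` even»
# (cell `bsd-print-cf2`, LEAD cruxlead-20509 g33, line `offtyz-v7`, lineage cycle 34; fact-free, Theses-free, `def`-free, field-free)

HONEST FRAMING (`--supports stmt-BirchSwinnertonDyer-20509`; theorems only, no `sorry`, no new named fact).  BSD is not proved by any of this;
no class is closed by this file; item 23431 (C⁺) and crux 20509 stay OPEN.  Target (T3) of THEOREM A's road (`TheoremATargets.orbitProd_sq_of_targets`,
p812073; memo `Cruxes/RamifiedOffTYZOfFacts/Lines/offtyz_v7_TheoremARoad.md` §3c) asks: for every `g ∈ G = Gal(R/L₁)`, `g^m • s₀ = s₀` (`R = K^{(32)}`,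
`L₁ = K(i, √l)`, `m = [H_n : L_n] = h(−lq)/2`).  THE KEY SIMPLIFICATION (this cycle): the Hilbert class field `H ⊆ R` contains `a₀ = s₀² = X(τ)` and
`w = √l`, so the whole subgroup `Π = Gal(R/H)` acts on `s₀` by SIGNS — hence every `π²`, `π ∈ Π`, fixes `s₀` with NO reciprocity computation — and the
argument is pure group theory in `Γ = Gal(R/K) ↠ A = Gal(H/K) ≅ Cl(K)`:

  `res g ∈ A²` (the stabiliser of `w` maps onto the UNIQUE index-`2` subgroup `A²` of `A`, unique because `#A[2] = 2`), so `g = x²π`, `g^m = (x^m)²·π^m`;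
  `π^m` fixes `s₀` (`m` even); `res(x^m) ∈ A[2] = {1, res p}`, so `x^m ∈ Π` or `x^m ∈ pΠ`, and `(x^m)²` fixes `s₀` because `Π²` and `p²` do.

* `smul_pow_even_eq_self_of_sign` — if `π • s₀ = ±s₀` then `π^{2k} • s₀ = s₀`;
* `index_range_sq_eq_two` — `#A[2] = 2 ⟹ [A : A²] = 2`;
* `map_stabilizer_eq_range_sq` — the image of `Stab_Γ(w)` in `A` is `A²` (`w² ∈ K`: every `g` acts on `w` by `±1`; `Π` fixes `w`; some `g₀` moves `w`);
* ★ `pow_smul_eq_self_of_smul_eq` — **THE GLOBAL HALF OF (T3), ABSTRACTLY**: `g • w = w ⟹ g^m • s₀ = s₀`.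

The arithmetic inputs are discharged elsewhere: `#Cl(ℚ(√−lq))[2] = 2` (Gauss, tree `Quadratic.card_sq_eq_one_classGroup`), `4 ∣ h(−lq)` from
`(l/q) = 1` (Rédei–Reichardt, conjunct 7 of 𝔅_ram), the lift `p = (𝔭, R/K)` of the ambiguous class `[𝔭]`, `𝔭² = (l)`, with `p² = ((l), R/K)` fixing `s₀`
(`TheoremAOrderTwoLocal.artinSymbol_sq_mul_apply_sqrtX_eq_self`, p812177: `χ₈(l) = 1`), and `a₀, w ∈ H` (`TheoremAHilbertBridge`).

References: transfer in abelian groups [folklore]; [cite: NeukirchSchmidtWingberg2008, §1.5]; [cite: Rotman1995, Thm. 2.19]; LEAD g29 memo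
`Lines/offtyz_v7_ExactDescent.md` §2c; tree p810950, p811989, p812073, p812177.
-/

namespace Summit.BirchSwinnertonDyer.PrintCf2.TheoremAOrderTwoGroup

open MulAction Summit.BirchSwinnertonDyer.PrintCf2.TheoremACMAssembly
open Literature.NumberTheory.QuadraticFields.FourRankOne Literature.NumberTheory.NumberFields

variable {Γ A R : Type*} [CommGroup Γ] [CommGroup A] [CommRing R] [MulSemiringAction Γ R]

/-! ## §1 Signs -/

/-- If `π` acts on `s₀` by a sign then `π²` fixes `s₀`. [folklore] -/
theorem smul_sq_eq_self_of_sign {π : Γ} {s₀ : R} (h : π • s₀ = s₀ ∨ π • s₀ = -s₀) : (π ^ 2) • s₀ = s₀ := by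
  rw [pow_two, mul_smul]
  rcases h with h | h
  · rw [h, h]
  · rw [h, smul_neg, h, neg_neg]

/-- If `π` acts on `s₀` by a sign then every EVEN power of `π` fixes `s₀`. [folklore] -/
theorem smul_pow_even_eq_self_of_sign {π : Γ} {s₀ : R} (h : π • s₀ = s₀ ∨ π • s₀ = -s₀) {m : ℕ} (hm : Even m) :
    (π ^ m) • s₀ = s₀ := by
  obtain ⟨k, rfl⟩ := hm
  rw [← two_mul, pow_mul]
  induction k with
  | zero => rw [pow_zero, one_smul]
  | succ k ih => rw [pow_succ, mul_smul, smul_sq_eq_self_of_sign h, ih]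

/-- In a domain: if `π` fixes `s₀²` then `π` acts on `s₀` by a sign, so `π²` fixes `s₀`. [folklore] -/
theorem smul_sq_eq_self_of_smul_mul_self [IsDomain R] {π : Γ} {s₀ : R} (h : π • (s₀ * s₀) = s₀ * s₀) : (π ^ 2) • s₀ = s₀ :=
  smul_sq_eq_self_of_sign (smul_eq_self_or_neg_of_smul_sq_eq h)

/-! ## §2 The squares of a finite abelian group with two `2`-torsion elements -/

/-- `#A[2] = 2 ⟹ [A : A²] = 2` (`A/A[2] ≅ A²`). [folklore] [cite: Rotman1995, Thm. 2.19] -/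
theorem index_range_sq_eq_two [Finite A] (h2 : Nat.card {c : A // c ^ 2 = 1} = 2) :
    (powMonoidHom (α := A) 2).range.index = 2 := by
  rw [index_range_powMonoidHom_eq_card_ker']
  refine (Nat.card_congr (Equiv.subtypeEquivRight fun c => ?_)).trans h2
  rw [MonoidHom.mem_ker, powMonoidHom_apply]

/-- Every element of `A` raised to `#A` is `1`; so `(c^m)² = 1` when `#A = 2m`. [folklore] -/
theorem pow_sq_eq_one_of_card [Finite A] {m : ℕ} (hcard : Nat.card A = 2 * m) (c : A) : (c ^ m) ^ 2 = 1 := by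
  rw [← pow_mul, mul_comm, ← hcard, pow_card_eq_one']

/-! ## §3 The stabiliser of `w` maps onto `A²` -/

/-- If every element acts on `w` by a sign, every SQUARE fixes `w`. [folklore] -/
theorem sq_mem_stabilizer_of_sign {w : R} (hw : ∀ g : Γ, g • w = w ∨ g • w = -w) (x : Γ) : x ^ 2 ∈ stabilizer Γ w := by
  rw [mem_stabilizer_iff]
  exact smul_sq_eq_self_of_sign (hw x)

/-- ★ **The image of `Stab_Γ(w)` under `res : Γ ↠ A` is exactly the subgroup of squares `A²`**, provided every `g` acts on `w` by a sign, `ker res`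
fixes `w`, some `g₀` moves `w`, and `#A[2] = 2` (so that `A²` is the unique subgroup of index `2`). [folklore] [cite: Rotman1995, Thm. 2.19] -/
theorem map_stabilizer_eq_range_sq [Finite A] (res : Γ →* A) (hres : Function.Surjective res) {w : R}
    (hw : ∀ g : Γ, g • w = w ∨ g • w = -w) (hkerw : ∀ π : Γ, res π = 1 → π • w = w) (hmove : ∃ g₀ : Γ, g₀ • w ≠ w)
    (h2 : Nat.card {c : A // c ^ 2 = 1} = 2) :
    (stabilizer Γ w).map res = (powMonoidHom (α := A) 2).range := by
  classical
  set B := (stabilizer Γ w).map res with hB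
  set S2 := (powMonoidHom (α := A) 2).range with hS2
  -- `A² ≤ B`
  have hle : S2 ≤ B := by
    rintro _ ⟨y, rfl⟩
    obtain ⟨x, rfl⟩ := hres y
    exact Subgroup.mem_map.mpr ⟨x ^ 2, sq_mem_stabilizer_of_sign hw x, by rw [map_pow, powMonoidHom_apply]⟩
  -- `B ≠ ⊤`
  have hne : B ≠ ⊤ := by
    intro htop
    obtain ⟨g₀, hg₀⟩ := hmove
    have hmem : res g₀ ∈ B := by rw [htop]; exact Subgroup.mem_top _
    obtain ⟨x, hx, hxg⟩ := Subgroup.mem_map.mp hmem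
    rw [mem_stabilizer_iff] at hx
    have hπ : res (g₀ * x⁻¹) = 1 := by rw [map_mul, map_inv, ← hxg, mul_inv_cancel]
    have h1 := hkerw _ hπ
    have hx' : x⁻¹ • w = w := by
      conv_lhs => rw [← hx]
      rw [inv_smul_smul]
    rw [mul_smul, hx'] at h1
    exact hg₀ h1
  -- indices: `[A : B] ∣ [A : A²] = 2`, `[A : B] ≠ 1`
  have hS2i : S2.index = 2 := index_range_sq_eq_two h2
  have hdvd : B.index ∣ 2 := by rw [← hS2i]; exact Subgroup.index_dvd_of_le hle
  have hBi : B.index = 2 := by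
    rcases (Nat.dvd_prime Nat.prime_two).mp hdvd with h | h
    · exact absurd (Subgroup.index_eq_one.mp h) hne
    · exact h
  -- equal index and `S2 ≤ B` give equality
  have hcard : Nat.card B = Nat.card S2 := by
    have h1 := B.card_mul_index
    have h2' := S2.card_mul_index
    rw [hBi] at h1
    rw [hS2i] at h2'
    omega
  exact (Subgroup.eq_of_le_of_card_ge hle hcard.le).symm

/-! ## §4 The global half of (T3), abstractly -/

/-- ★★ **(T3), GLOBAL HALF, AS GROUP THEORY.**  `Γ` a commutative group acting on the domain `R`, `res : Γ ↠ A` onto a finite commutative group with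
`#A = 2m`, `m` even, `#A[2] = 2`; `s₀, w ∈ R`, `w ≠ 0`; `ker res` fixes `s₀²` and `w`; every `g` acts on `w` by a sign and some `g₀` moves `w`; `p ∈ Γ`
with `res p ≠ 1`, `(res p)² = 1` and `p²` fixing `s₀`.  THEN every `g` fixing `w` has `g^m • s₀ = s₀`.
For THEOREM A: `Γ = Gal(K^{(32)}/K)`, `A = Gal(H/K) ≅ Cl(ℚ(√−lq))`, `m = h/2 = g(n)`, `s₀ = e⁻¹s(τ)`, `w = √l`, `p = (𝔭_l, K^{(32)}/K)`.
[folklore] [cite: NeukirchSchmidtWingberg2008, §1.5] [cite: Rotman1995, Thm. 2.19] -/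
theorem pow_smul_eq_self_of_smul_eq [IsDomain R] [Finite A] (res : Γ →* A) (hres : Function.Surjective res) (s₀ w : R)
    (hker : ∀ π : Γ, res π = 1 → π • (s₀ * s₀) = s₀ * s₀) (hkerw : ∀ π : Γ, res π = 1 → π • w = w)
    (hw : ∀ g : Γ, g • w = w ∨ g • w = -w) (hmove : ∃ g₀ : Γ, g₀ • w ≠ w)
    (h2 : Nat.card {c : A // c ^ 2 = 1} = 2)
    (p : Γ) (hp1 : res p ≠ 1) (hp2 : res p ^ 2 = 1) (hps : (p ^ 2) • s₀ = s₀)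
    {m : ℕ} (hcard : Nat.card A = 2 * m) (hm : Even m)
    (g : Γ) (hg : g • w = w) : (g ^ m) • s₀ = s₀ := by
  -- `res g` is a square
  have hmem : res g ∈ (stabilizer Γ w).map res := Subgroup.mem_map.mpr ⟨g, mem_stabilizer_iff.mpr hg, rfl⟩
  rw [map_stabilizer_eq_range_sq res hres hw hkerw hmove h2] at hmem
  obtain ⟨y, hy⟩ := MonoidHom.mem_range.mp hmem
  rw [powMonoidHom_apply] at hy
  obtain ⟨x, rfl⟩ := hres y
  -- `g = x² π` with `π ∈ ker res`
  set π := g * (x ^ 2)⁻¹ with hπdef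
  have hπ : res π = 1 := by rw [hπdef, map_mul, map_inv, map_pow, hy, mul_inv_cancel]
  have hg' : g = x ^ 2 * π := by rw [hπdef, mul_comm, inv_mul_cancel_right]
  -- `π^m` fixes `s₀`
  have hπm : (π ^ m) • s₀ = s₀ := smul_pow_even_eq_self_of_sign (smul_eq_self_or_neg_of_smul_sq_eq (hker π hπ)) hm
  -- `(x^m)²` fixes `s₀`: `res (x^m) ∈ A[2] = {1, res p}`
  have hxm : ((x ^ m) ^ 2) • s₀ = s₀ := by
    have hc : (res (x ^ m)) ^ 2 = 1 := by rw [map_pow]; exact pow_sq_eq_one_of_card hcard (res x)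
    rcases eq_one_or_eq_of_natCard_sq_eq_one_eq_two hp1 hp2 h2 _ hc with h1 | h1
    · exact smul_sq_eq_self_of_smul_mul_self (hker _ h1)
    · -- `x^m = p π'`, `π' ∈ ker res`
      set π' := x ^ m * p⁻¹ with hπ'def
      have hπ' : res π' = 1 := by rw [hπ'def, map_mul, map_inv, h1, mul_inv_cancel]
      have hxm' : x ^ m = p * π' := by rw [hπ'def, mul_comm, inv_mul_cancel_right]
      rw [hxm', mul_pow, mul_smul, smul_sq_eq_self_of_smul_mul_self (hker _ hπ'), hps]
  -- assemble
  rw [hg', mul_pow, ← pow_mul, mul_comm 2 m, pow_mul, mul_smul, hπm, hxm]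

end Summit.BirchSwinnertonDyer.PrintCf2.TheoremAOrderTwoGroup
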